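import Summits.BirchSwinnertonDyer.BirchSwinnertonDyer.Theorems.AlignedTransportAtTwoMainConjectureOfRankZeroBSDAtTwoCubicRankDoorModels
import Summits.BirchSwinnertonDyer.BirchSwinnertonDyer.Theorems.AlignedTransportAtTwoMainConjectureOfRankZeroBSDAtTwoCubicOffStratumFukudaIndex
import HarnessLib

/-!
# Route `AlignedTransportAtTwo`, crux C2 `MainConjectureOfRankZeroBSDAtTwo` (stmt-22298), line `birth` — THE NARROW RANK DOORS AT EVERY RUNG `m ≥ 0`
# (BOTH SIGNS OF `Δ_W`): Fukuda's index is `0` for the cubic `2`-torsion field of every good-ordinary curve with `E(ℚ)[2] = 0`, so the narrow rung may be taken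
# at the pair `(0, 1)` too — narrow class groups of ONE cubic and ONE sextic field; the first `0 < Δ` row `27735d1` at the rung `0` (degrees `3` and `6`, not `6` and `12`)

HONEST FRAMING (cell `bsd-f1-sign2`, WIDTH-5 attach seat `bsd-line-att-p4` g26, lineage att-p4 = route-ledger lane; `--supports stmt-BirchSwinnertonDyer-22298
--as helper`). THEOREMS ONLY (no `def`, no named fact, no `sorry`, no instance). BSD is NOT proved; C2 is NOT closed; its verdict «blocked-on
`Rank1Residual.GreenbergMuConjectureIrreducible`» is untouched; every door / row is CONDITIONAL on the displayed PRINT named facts {Kato 17.4 (1)(2) at `2`,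
Greenberg 4.1, period unit, modularity, GZK}, the registered stub MuIneqʳ (verbatim) and ONE displayed per-curve NARROW certificate (a finite computation NOT
performed here). No new mathematics: cell bsd-2adic w2 GEN 11's `NarrowFukuda.narrowMu_of_layer_models` / `…_of_index_le_of_succ_eq` (rung `m` under «Fukuda
index `≤ m`») with the index hypothesis discharged at EVERY `m ≥ 0` by att-p5 g28's `…CubicOffStratumFukudaIndex.totallyRamifiedFrom_zero_adjoin_of_isOrdinaryAt_two`
(index `0` for `ℚ(β)`, every stratum), then att-p5 g24's Kida-lite road `…CubicCarrierRoad.mazurMainConjecture_two_of_muIneqRel_of_narrowMu_cubicField`.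

WHY. g25's narrow doors (`…CubicNarrowRankDoor.mazurMainConjecture_two_of_muIneqRel_of_narrowRung`, `…CubicRankDoorModels.…_of_narrowClassGroup_layer_models`)
carry `1 ≤ m` because bsd-2adic's cubic certificate discharged the index only as `≤ 1` (degree `3 < 4`). With index `0` the cheapest narrow certificate is the pair
`(0, 1)`: `[Cl⁺(ℚ(β)(√2)) : (Cl⁺)²] = [Cl⁺(ℚ(β)) : (Cl⁺)²]` — for the `0 < Δ_W` sub-cell (totally real `ℚ(β)`), where the narrow rung is the route's ONLY finite
certificate shape, this halves the degrees -data must handle (`bnfnarrow` of degrees `3`, `6` instead of `6`, `12`).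

* §1 `narrowMuData_adjoin_of_narrowRung_anyRung` (abstract layers) / `narrowMuData_adjoin_of_narrowClassGroup_layer_models_anyRung` (models): for `W` good ordinary
  at `2` with no rational `2`-torsion abscissa and `β` a root of the `2`-division cubic, ONE narrow rung `m ≥ 0` ⟹ Kida-lite's data (a) `μ₂ = 0` for every cyclotomic
  `ℤ₂`-extension of `ℚ(β)` ∧ (b) ONE uniform narrow-defect bound; `exists_narrowRung_anyRung_iff_narrowMuData` (the `1 ≤ m` of g25's ledger equivalence
  `exists_narrowRung_iff_narrowMuData` is removable).
* §2 **THE NARROW DOORS AT EVERY RUNG `m ≥ 0`, BOTH SIGNS, `hμan`-free**: `mazurMainConjecture_two_of_muIneqRel_of_narrowRung_anyRung` (abstract layers),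
  `mazurMainConjecture_two_of_muIneqRel_of_narrowClassGroup_layer_models_anyRung` (models `L`, `L'` of degrees `2^m`, `2^{m+1}` over `ℚ(β)` with roots of `Ψ_m`,
  `Ψ_{m+1}` and **`[Cl⁺(L') : Cl⁺(L')²] = [Cl⁺(L) : Cl⁺(L)²]`**).
* §3 **THE NARROW RUNG `0` ON MODELS**: `L ⊇ ℚ(β)` of degree `1` (ANY model of the cubic field itself, e.g. `ℚ(u)` given by the `u`-cubic) and `L' ⊇ ℚ(β)` of
  degree `2` with `θ² = 2`: `mazurMainConjecture_two_of_muIneqRel_of_narrowClassGroup_rungZero_models`.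
* §4 ROW `27735d1` (THE FIRST `0 < Δ_W` ROW, `N = 3·5·43`, `Δ_min ≡ 7 (mod 8)`) AT THE NARROW RUNG `0`: PRINT⁵ + MuIneqʳ + displayed {`r_an = 0`, `BSD₂(27735d1)`, a
  model `L` of `ℚ(β)` (degree `3`, `4β³ + 5β² − 15391228β − 10203477656 = 0`) and a quadratic `L' ∋ √2` over it (degree `6`) with **equal narrow 2-ranks**} ⟹
  `MC₂(27735d1)`. DATA ASK (-data): `bnfnarrow` of the cubic and of the sextic `ℚ(β, √2)` — replaces g25's degree-`6`/`12` ask (c).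

PARTITION (D-0171): none moved. Beyond-print theorem: no ([Fukuda1994] Thm. 1 (2), [Washington1997] §13.1, [Kida1982JFields] shape, bookkeeping). BSD is NOT proved.

References: [Fukuda1994] Thm. 1 (2), p. 264; [Washington1997] §13.1, Lemma 13.3; [Kida1982JFields] (μ-part; shape); [Iwasawa1973MuInvariants] Thm. 2/3;
[Kato2004Asterisque] Thm. 17.4 (1)(2) (p. 273); [GreenbergLNM1716] Thm. 4.1 (p. 102), Conj. 1.11 (p. 58); [CremonaAlgorithms1997] Table 1 (`27735d1`);
tree p756150 / p757810 (g25), p757530 (g28 index `0`), bsd-2adic w2 GEN 8–11.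
-/

set_option linter.dupNamespace false
set_option autoImplicit false

noncomputable section

open scoped MatrixGroups ModularForm NumberField Classical
open CongruenceSubgroup WeierstrassCurve Polynomial NumberField Module Field
open Literature.NumberTheory.EllipticCurves Literature.NumberTheory.EllipticCurves.ModularForms
open Literature.NumberTheory.EllipticCurves.Greenberg1999 Literature.NumberTheory.EllipticCurves.Module
open Literature.NumberTheory.EllipticCurves.Rank1Residual Literature.NumberTheory.EllipticCurves.Rank1Residual.Typed
open Literature.NumberTheory.GaloisRepresentations Literature.NumberTheory.IwasawaTheory
open Literature.NumberTheory.NumberFields (narrowClassNumber NarrowClassGroup)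
open Summit.BirchSwinnertonDyer.Rank1Residual Summit.BirchSwinnertonDyer.Rank1Residual.F1Sign2
open Summit.BirchSwinnertonDyer.Rank1Residual.X1.MuLambda Summit.BirchSwinnertonDyer.Rank1Residual.X5
open Summit.BirchSwinnertonDyer.Rank1Residual.X5.Instances
open Summit.BirchSwinnertonDyer.BirchSwinnertonDyer.Theorems.Rank1ResidualX1Defs
open Summit.BirchSwinnertonDyer.BirchSwinnertonDyer.Theses.AlignedTransportAtTwo
open Summit.BirchSwinnertonDyer.BirchSwinnertonDyer.Theorems.AlignedTransportAtTwoCubicNarrowRankDoor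
  (finrank_adjoin_eq_three_of_forall_not_hasRationalTwoTorsionX exists_narrowRung_iff_narrowMuData)
open Summit.BirchSwinnertonDyer.BirchSwinnertonDyer.Theorems.AlignedTransportAtTwoCubicCarrierRoad
  (mazurMainConjecture_two_of_muIneqRel_of_narrowMu_cubicField)
open Summit.BirchSwinnertonDyer.BirchSwinnertonDyer.Theorems.AlignedTransportAtTwoCubicOffStratumFukudaIndex
  (totallyRamifiedFrom_zero_adjoin_of_isOrdinaryAt_two)
open Summit.BirchSwinnertonDyer.BirchSwinnertonDyer.Theorems.AlignedTransportAtTwoCubicRankDoorModels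
  (not_hasRationalTwoTorsionX_27735d1)
open Summit.BirchSwinnertonDyer.BirchSwinnertonDyer.Theorems.TowerClass
open Summit.BirchSwinnertonDyer.BirchSwinnertonDyer.Theorems (AnalyticMuTwo.red_ne_zero_of_isEvenBranchLiftAtTwo_of_forall_not_hasRationalTwoTorsionX)

namespace Summit.BirchSwinnertonDyer.BirchSwinnertonDyer.Theorems.AlignedTransportAtTwoCubicNarrowRankDoorModelsAnyRung

/-! ## §1 One narrow rung `m ≥ 0` ⟹ Kida-lite's narrow `μ₂`-data of `ℚ(β)` -/

section NarrowMu

variable (W : WeierstrassCurve ℚ) [W.IsElliptic] [W.IsGloballyMinimal]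

/-- **ONE NARROW RUNG `m ≥ 0` (abstract layers) ⟹ narrow `μ₂`-data.** `W` good ordinary at `2`, no rational `2`-torsion abscissa, `β` a root of the
`2`-division cubic; if every cyclotomic `ℤ₂`-extension `κP` of `ℚ(β)` has `[Cl⁺(ℚ(β)_{m+1}) : (Cl⁺)²] = [Cl⁺(ℚ(β)_m) : (Cl⁺)²]` (any `NumberField` instances on the
layers), then (a) `μ₂(κP) = 0` for every cyclotomic `κP` and (b) ONE `D` bounds `ord₂ h⁺ − ord₂ h` on every layer of every cyclotomic `κP`. The index
hypothesis of bsd-2adic's `NarrowFukuda.narrowMu_of_index_le_of_succ_eq` is g28's index `0` (every stratum), so `m = 0` is allowed. [cite: Fukuda1994, Thm. 1 (2), p. 264]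
[cite: Kida1982JFields, main theorem (μ-part; shape only)] [cite: Washington1997, §13.1] -/
theorem narrowMuData_adjoin_of_narrowRung_anyRung (hord : IsOrdinaryAt W 2) (ht : ∀ x : ℚ, ¬ HasRationalTwoTorsionX W x)
    {β : AlgebraicClosure ℚ} (hβ : aeval β W.twoTorsionPolynomial.toPoly = 0) {m : ℕ}
    (hcert : ∀ κP : ZpExtension ↥(IntermediateField.adjoin ℚ ({β} : Set (AlgebraicClosure ℚ))) 2, κP.IsCyclotomic →
      ∀ [NumberField (κP.layer m)] [NumberField (κP.layer (m + 1))],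
        (powMonoidHom (α := NarrowClassGroup (κP.layer (m + 1))) 2).range.index =
          (powMonoidHom (α := NarrowClassGroup (κP.layer m)) 2).range.index) :
    (∀ κP : ZpExtension ↥(IntermediateField.adjoin ℚ ({β} : Set (AlgebraicClosure ℚ))) 2, κP.IsCyclotomic → ClassicalMuVanishes κP) ∧
    ∃ D : ℕ, ∀ κP : ZpExtension ↥(IntermediateField.adjoin ℚ ({β} : Set (AlgebraicClosure ℚ))) 2, κP.IsCyclotomic → ∀ j : ℕ,
      ∀ [NumberField (κP.layer j)], padicValNat 2 (narrowClassNumber (κP.layer j)) ≤ padicValNat 2 (classNumber (κP.layer j)) + D := by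
  haveI : FiniteDimensional ℚ ↥(IntermediateField.adjoin ℚ ({β} : Set (AlgebraicClosure ℚ))) :=
    IntermediateField.adjoin.finiteDimensional ((AlgebraicClosure.isAlgebraic ℚ).isAlgebraic β).isIntegral
  haveI : NumberField ↥(IntermediateField.adjoin ℚ ({β} : Set (AlgebraicClosure ℚ))) := NumberField.mk
  exact NarrowFukuda.narrowMu_of_index_le_of_succ_eq _ m
    (fun κP hκP => (totallyRamifiedFrom_zero_adjoin_of_isOrdinaryAt_two W hord ht hβ κP hκP).mono (Nat.zero_le m)) hcert

/-- **ONE NARROW RUNG `m ≥ 0` ON MODELS ⟹ narrow `μ₂`-data.** The same with number fields `L ⊇ ℚ(β)` of degree `2^m` with a root of `Ψ_m` and `L' ⊇ ℚ(β)` of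
degree `2^{m+1}` with a root of `Ψ_{m+1}` and **`[Cl⁺(L') : Cl⁺(L')²] = [Cl⁺(L) : Cl⁺(L)²]`** (bsd-2adic `NarrowFukuda.narrowMu_of_layer_models`, index `0` by g28).
[cite: Fukuda1994, Thm. 1 (2), p. 264] [cite: Kida1982JFields, main theorem (μ-part; shape only)] [cite: Washington1997, §13.1] -/
theorem narrowMuData_adjoin_of_narrowClassGroup_layer_models_anyRung (hord : IsOrdinaryAt W 2) (ht : ∀ x : ℚ, ¬ HasRationalTwoTorsionX W x)
    {β : AlgebraicClosure ℚ} (hβ : aeval β W.twoTorsionPolynomial.toPoly = 0) {m : ℕ}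
    (L : Type) [Field L] [NumberField L] [Algebra ↥(IntermediateField.adjoin ℚ ({β} : Set (AlgebraicClosure ℚ))) L]
    (hL : Module.finrank ↥(IntermediateField.adjoin ℚ ({β} : Set (AlgebraicClosure ℚ))) L = 2 ^ m) (θ : L)
    (hθ : (fun x : L => x ^ 2 - 2)^[m] θ = 0)
    (L' : Type) [Field L'] [NumberField L'] [Algebra ↥(IntermediateField.adjoin ℚ ({β} : Set (AlgebraicClosure ℚ))) L']
    (hL' : Module.finrank ↥(IntermediateField.adjoin ℚ ({β} : Set (AlgebraicClosure ℚ))) L' = 2 ^ (m + 1)) (θ' : L')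
    (hθ' : (fun x : L' => x ^ 2 - 2)^[m + 1] θ' = 0)
    (hnarrow : (powMonoidHom (α := NarrowClassGroup L') 2).range.index = (powMonoidHom (α := NarrowClassGroup L) 2).range.index) :
    (∀ κP : ZpExtension ↥(IntermediateField.adjoin ℚ ({β} : Set (AlgebraicClosure ℚ))) 2, κP.IsCyclotomic → ClassicalMuVanishes κP) ∧
    ∃ D : ℕ, ∀ κP : ZpExtension ↥(IntermediateField.adjoin ℚ ({β} : Set (AlgebraicClosure ℚ))) 2, κP.IsCyclotomic → ∀ j : ℕ,
      ∀ [NumberField (κP.layer j)], padicValNat 2 (narrowClassNumber (κP.layer j)) ≤ padicValNat 2 (classNumber (κP.layer j)) + D := by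
  haveI : FiniteDimensional ℚ ↥(IntermediateField.adjoin ℚ ({β} : Set (AlgebraicClosure ℚ))) :=
    IntermediateField.adjoin.finiteDimensional ((AlgebraicClosure.isAlgebraic ℚ).isAlgebraic β).isIntegral
  haveI : NumberField ↥(IntermediateField.adjoin ℚ ({β} : Set (AlgebraicClosure ℚ))) := NumberField.mk
  have h3 := finrank_adjoin_eq_three_of_forall_not_hasRationalTwoTorsionX W ht hβ
  exact NarrowFukuda.narrowMu_of_layer_models _ (by rw [h3]; decide) m
    (fun κP hκP => (totallyRamifiedFrom_zero_adjoin_of_isOrdinaryAt_two W hord ht hβ κP hκP).mono (Nat.zero_le m))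
    L hL θ hθ L' hL' θ' hθ' hnarrow

/-- **The narrow rung without `1 ≤ m` ⟺ Kida-lite's narrow `μ₂`-data** (per curve): g25's ledger equivalence `exists_narrowRung_iff_narrowMuData` with the
restriction `1 ≤ m` DELETED from the rung side — so the `0 < Δ_W` ledger binder hRankPos (p756474) may read `∃ m ≥ 0`. [cite: Fukuda1994, Thm. 1 (2), p. 264]
[cite: Kida1982JFields, main theorem (μ-part; shape only)] -/
theorem exists_narrowRung_anyRung_iff_narrowMuData (hord : IsOrdinaryAt W 2) (ht : ∀ x : ℚ, ¬ HasRationalTwoTorsionX W x)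
    {β : AlgebraicClosure ℚ} (hβ : aeval β W.twoTorsionPolynomial.toPoly = 0) :
    (∃ m : ℕ, ∀ κP : ZpExtension ↥(IntermediateField.adjoin ℚ ({β} : Set (AlgebraicClosure ℚ))) 2, κP.IsCyclotomic →
        ∀ [NumberField (κP.layer m)] [NumberField (κP.layer (m + 1))],
          (powMonoidHom (α := NarrowClassGroup (κP.layer (m + 1))) 2).range.index =
            (powMonoidHom (α := NarrowClassGroup (κP.layer m)) 2).range.index) ↔
      ∃ D : ℕ, ∀ κP : ZpExtension ↥(IntermediateField.adjoin ℚ ({β} : Set (AlgebraicClosure ℚ))) 2, κP.IsCyclotomic →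
        ClassicalMuVanishes κP ∧ ∀ n : ℕ, ∀ [NumberField ↥(κP.layer n)],
          padicValNat 2 (narrowClassNumber ↥(κP.layer n)) ≤ padicValNat 2 (classNumber ↥(κP.layer n)) + D := by
  -- instance binders `[NumberField ↥(κP.layer _)]` are threaded EXPLICITLY (`@`): leaving one to typeclass synthesis does not fail fast but times out
  constructor
  · rintro ⟨m, hm⟩
    obtain ⟨hμ, D, hδ⟩ := narrowMuData_adjoin_of_narrowRung_anyRung W hord ht hβ hm
    refine ⟨D, fun κP hκP => ⟨hμ κP hκP, ?_⟩⟩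
    intro n inst
    exact @hδ κP hκP n inst
  · rintro ⟨D, hD⟩
    have h' := (exists_narrowRung_iff_narrowMuData W ht hβ).mpr
    specialize h' ⟨D, fun κP hκP => ⟨(hD κP hκP).1, by
      have h2 := (hD κP hκP).2
      intro n inst
      have h4 := @h2 n inst
      exact h4⟩⟩
    obtain ⟨m, -, hm⟩ := h'
    refine ⟨m, fun κP hκP => ?_⟩
    have h3 := @hm κP hκP
    intro i1 i2
    exact @h3 i1 i2

end NarrowMu

/-! ## §2 The narrow doors at every rung `m ≥ 0`, both signs of `Δ_W` -/

section Doors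

variable (W : WeierstrassCurve ℚ) [W.IsElliptic] [W.IsGloballyMinimal]

/-- **THE NARROW RANK DOOR AT ANY RUNG `m ≥ 0`, abstract layers, BOTH signs of `Δ_W`.** PRINT⁵ {Kato 17.4 (1)(2) at `2`, Greenberg 4.1, period unit, modularity,
GZK} + MuIneqʳ (verbatim) + cell hypotheses (good ordinary at `2`, no rational `2`-torsion abscissa, `r_an = 0`, `BSD₂(W)`) + `β` + ONE rung `m ≥ 0` of NARROW
2-ranks `[Cl⁺(ℚ(β)_{m+1}) : (Cl⁺)²] = [Cl⁺(ℚ(β)_m) : (Cl⁺)²]` for every cyclotomic `ℤ₂`-extension of `ℚ(β)` ⟹ `MC₂(W)` — g25's `…_of_narrowRung` (p756150) with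
`1 ≤ m` DELETED; no sign / `Δ_min mod 8` / ramification / `hμan` binder. CONDITIONAL; nothing closed; BSD is NOT proved. [cite: Fukuda1994, Thm. 1 (2), p. 264]
[cite: Kida1982JFields, main theorem (μ-part; shape only)] [cite: Kato2004Asterisque, Thm. 17.4 (1)(2) (p. 273)] [cite: GreenbergLNM1716, Thm. 4.1 (p. 102) and Conj. 1.11 (p. 58)] -/
theorem mazurMainConjecture_two_of_muIneqRel_of_narrowRung_anyRung
    (h17 : ∀ [NeZero (W.conductorNorm ℤ)] (f : CuspForm (Gamma0 (W.conductorNorm ℤ)) 2),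
      kato_divisibility_allPrimes W 2 (f := f))
    (hGr : Greenberg1999.thm41_charValue_rankZero_anyPrime)
    (hper : realPeriodRat_eq_unit_mul_plusPeriod_two) (hmod : nonempty_modularParametrizationData)
    (hGZK : rank_eq_analyticRank_of_analyticRank_le_one)
    (hI : ∀ (W : WeierstrassCurve ℚ) [W.IsElliptic] [W.IsGloballyMinimal], IsOrdinaryAt W 2 →
      (∀ x : ℚ, ¬ HasRationalTwoTorsionX W x) →
      ∀ (κ : ZpExtension ℚ 2) (γ : Field.absoluteGaloisGroup ℚ), κ.IsCyclotomic →
      κ.IsTopGenerator γ → IsCyclotomicVariable 2 γ →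
      ∀ ⦃N : ℕ⦄ [NeZero N] (f : CuspForm (Gamma0 N) 2), IsNewformOf W f →
      ∀ Gp : IwasawaAlgebra 2, iwasawaToPowerSeries 2 Gp = padicLFunction f (unitRoot W 2 : ℚ_[2]) →
      ∀ (D : W.SelmerDualData κ γ) (Yr : W.FineSelmerDualDataRelaxedInf κ γ),
        lengthAt (IwasawaAlgebra 2) D.X ⟨IwasawaAlgebra.augIdealP 2, IwasawaAlgebra.isPrime_augIdealP_holds 2⟩ ≤
          lengthAt (IwasawaAlgebra 2) (IwasawaAlgebra 2 ⧸ Ideal.span {Gp})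
              ⟨IwasawaAlgebra.augIdealP 2, IwasawaAlgebra.isPrime_augIdealP_holds 2⟩ +
            lengthAt (IwasawaAlgebra 2) Yr.X ⟨IwasawaAlgebra.augIdealP 2, IwasawaAlgebra.isPrime_augIdealP_holds 2⟩)
    (hord : IsOrdinaryAt W 2) (ht : ∀ x : ℚ, ¬ HasRationalTwoTorsionX W x) (hr : W.analyticRank = 0) (hbsd : BSDp W 2)
    {β : AlgebraicClosure ℚ} (hβ : aeval β W.twoTorsionPolynomial.toPoly = 0) {m : ℕ}
    (hcert : ∀ κP : ZpExtension ↥(IntermediateField.adjoin ℚ ({β} : Set (AlgebraicClosure ℚ))) 2, κP.IsCyclotomic →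
      ∀ [NumberField (κP.layer m)] [NumberField (κP.layer (m + 1))],
        (powMonoidHom (α := NarrowClassGroup (κP.layer (m + 1))) 2).range.index =
          (powMonoidHom (α := NarrowClassGroup (κP.layer m)) 2).range.index) :
    MazurMainConjecture W 2 := by
  obtain ⟨hμ, D, hδ⟩ := narrowMuData_adjoin_of_narrowRung_anyRung W hord ht hβ hcert
  exact mazurMainConjecture_two_of_muIneqRel_of_narrowMu_cubicField W h17 hGr hper hmod hGZK hI hord ht hr
    (AnalyticMuTwo.red_ne_zero_of_isEvenBranchLiftAtTwo_of_forall_not_hasRationalTwoTorsionX W hord ht) hbsd hβ hμ D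
    (fun κP hκP n inst => @hδ κP hκP n inst)

/-- **THE NARROW MODELS DOOR AT ANY RUNG `m ≥ 0`, BOTH signs of `Δ_W`.** PRINT⁵ + MuIneqʳ + cell hypotheses + `β` + models `L ⊇ ℚ(β)` (degree `2^m`, root of
`Ψ_m`), `L' ⊇ ℚ(β)` (degree `2^{m+1}`, root of `Ψ_{m+1}`) with **`[Cl⁺(L') : Cl⁺(L')²] = [Cl⁺(L) : Cl⁺(L)²]`** ⟹ `MC₂(W)` — g25's `…_of_narrowClassGroup_layer_models`
(p757810) with `1 ≤ m` DELETED. CONDITIONAL; nothing closed; BSD is NOT proved. [cite: Fukuda1994, Thm. 1 (2), p. 264] [cite: Washington1997, §13.1]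
[cite: Kida1982JFields, main theorem (μ-part; shape only)] [cite: Kato2004Asterisque, Thm. 17.4 (1)(2) (p. 273)] [cite: GreenbergLNM1716, Thm. 4.1 (p. 102)] -/
theorem mazurMainConjecture_two_of_muIneqRel_of_narrowClassGroup_layer_models_anyRung
    (h17 : ∀ [NeZero (W.conductorNorm ℤ)] (f : CuspForm (Gamma0 (W.conductorNorm ℤ)) 2),
      kato_divisibility_allPrimes W 2 (f := f))
    (hGr : Greenberg1999.thm41_charValue_rankZero_anyPrime)
    (hper : realPeriodRat_eq_unit_mul_plusPeriod_two) (hmod : nonempty_modularParametrizationData)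
    (hGZK : rank_eq_analyticRank_of_analyticRank_le_one)
    (hI : ∀ (W : WeierstrassCurve ℚ) [W.IsElliptic] [W.IsGloballyMinimal], IsOrdinaryAt W 2 →
      (∀ x : ℚ, ¬ HasRationalTwoTorsionX W x) →
      ∀ (κ : ZpExtension ℚ 2) (γ : Field.absoluteGaloisGroup ℚ), κ.IsCyclotomic →
      κ.IsTopGenerator γ → IsCyclotomicVariable 2 γ →
      ∀ ⦃N : ℕ⦄ [NeZero N] (f : CuspForm (Gamma0 N) 2), IsNewformOf W f →
      ∀ Gp : IwasawaAlgebra 2, iwasawaToPowerSeries 2 Gp = padicLFunction f (unitRoot W 2 : ℚ_[2]) →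
      ∀ (D : W.SelmerDualData κ γ) (Yr : W.FineSelmerDualDataRelaxedInf κ γ),
        lengthAt (IwasawaAlgebra 2) D.X ⟨IwasawaAlgebra.augIdealP 2, IwasawaAlgebra.isPrime_augIdealP_holds 2⟩ ≤
          lengthAt (IwasawaAlgebra 2) (IwasawaAlgebra 2 ⧸ Ideal.span {Gp})
              ⟨IwasawaAlgebra.augIdealP 2, IwasawaAlgebra.isPrime_augIdealP_holds 2⟩ +
            lengthAt (IwasawaAlgebra 2) Yr.X ⟨IwasawaAlgebra.augIdealP 2, IwasawaAlgebra.isPrime_augIdealP_holds 2⟩)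
    (hord : IsOrdinaryAt W 2) (ht : ∀ x : ℚ, ¬ HasRationalTwoTorsionX W x) (hr : W.analyticRank = 0) (hbsd : BSDp W 2)
    {β : AlgebraicClosure ℚ} (hβ : aeval β W.twoTorsionPolynomial.toPoly = 0) {m : ℕ}
    (L : Type) [Field L] [NumberField L] [Algebra ↥(IntermediateField.adjoin ℚ ({β} : Set (AlgebraicClosure ℚ))) L]
    (hL : Module.finrank ↥(IntermediateField.adjoin ℚ ({β} : Set (AlgebraicClosure ℚ))) L = 2 ^ m) (θ : L)
    (hθ : (fun x : L => x ^ 2 - 2)^[m] θ = 0)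
    (L' : Type) [Field L'] [NumberField L'] [Algebra ↥(IntermediateField.adjoin ℚ ({β} : Set (AlgebraicClosure ℚ))) L']
    (hL' : Module.finrank ↥(IntermediateField.adjoin ℚ ({β} : Set (AlgebraicClosure ℚ))) L' = 2 ^ (m + 1)) (θ' : L')
    (hθ' : (fun x : L' => x ^ 2 - 2)^[m + 1] θ' = 0)
    (hnarrow : (powMonoidHom (α := NarrowClassGroup L') 2).range.index = (powMonoidHom (α := NarrowClassGroup L) 2).range.index) :
    MazurMainConjecture W 2 := by
  obtain ⟨hμ, D, hδ⟩ := narrowMuData_adjoin_of_narrowClassGroup_layer_models_anyRung W hord ht hβ L hL θ hθ L' hL' θ' hθ' hnarrow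
  exact mazurMainConjecture_two_of_muIneqRel_of_narrowMu_cubicField W h17 hGr hper hmod hGZK hI hord ht hr
    (AnalyticMuTwo.red_ne_zero_of_isEvenBranchLiftAtTwo_of_forall_not_hasRationalTwoTorsionX W hord ht) hbsd hβ hμ D
    (fun κP hκP n inst => @hδ κP hκP n inst)

/-! ## §3 The narrow rung `0` on models: the cubic field itself and one quadratic extension with `√2` -/

/-- **THE NARROW RUNG-`0` DOOR ON MODELS, BOTH signs of `Δ_W`.** PRINT⁵ + MuIneqʳ + cell hypotheses + `β` + a number field `L ⊇ ℚ(β)` of degree `1` (ANY model of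
the cubic field `ℚ(β)` itself — e.g. given by any polynomial generating it) and `L' ⊇ ℚ(β)` of degree `2` containing `θ` with `θ² = 2` (ANY model of `ℚ(β)(√2)`),
with **`[Cl⁺(L') : Cl⁺(L')²] = [Cl⁺(L) : Cl⁺(L)²]`** (equal NARROW 2-ranks of the class groups of ONE cubic and ONE sextic field) ⟹ `MC₂(W)`. On `0 < Δ_W` this is the
route's cheapest finite certificate. CONDITIONAL; nothing closed; BSD is NOT proved. [cite: Fukuda1994, Thm. 1 (2), p. 264] [cite: Washington1997, §13.1 (`K_0 = K`, `K_1 = K(√2)`)]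
[cite: Kida1982JFields, main theorem (μ-part; shape only)] [cite: Kato2004Asterisque, Thm. 17.4 (1)(2) (p. 273)] [cite: GreenbergLNM1716, Thm. 4.1 (p. 102)] -/
theorem mazurMainConjecture_two_of_muIneqRel_of_narrowClassGroup_rungZero_models
    (h17 : ∀ [NeZero (W.conductorNorm ℤ)] (f : CuspForm (Gamma0 (W.conductorNorm ℤ)) 2),
      kato_divisibility_allPrimes W 2 (f := f))
    (hGr : Greenberg1999.thm41_charValue_rankZero_anyPrime)
    (hper : realPeriodRat_eq_unit_mul_plusPeriod_two) (hmod : nonempty_modularParametrizationData)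
    (hGZK : rank_eq_analyticRank_of_analyticRank_le_one)
    (hI : ∀ (W : WeierstrassCurve ℚ) [W.IsElliptic] [W.IsGloballyMinimal], IsOrdinaryAt W 2 →
      (∀ x : ℚ, ¬ HasRationalTwoTorsionX W x) →
      ∀ (κ : ZpExtension ℚ 2) (γ : Field.absoluteGaloisGroup ℚ), κ.IsCyclotomic →
      κ.IsTopGenerator γ → IsCyclotomicVariable 2 γ →
      ∀ ⦃N : ℕ⦄ [NeZero N] (f : CuspForm (Gamma0 N) 2), IsNewformOf W f →
      ∀ Gp : IwasawaAlgebra 2, iwasawaToPowerSeries 2 Gp = padicLFunction f (unitRoot W 2 : ℚ_[2]) →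
      ∀ (D : W.SelmerDualData κ γ) (Yr : W.FineSelmerDualDataRelaxedInf κ γ),
        lengthAt (IwasawaAlgebra 2) D.X ⟨IwasawaAlgebra.augIdealP 2, IwasawaAlgebra.isPrime_augIdealP_holds 2⟩ ≤
          lengthAt (IwasawaAlgebra 2) (IwasawaAlgebra 2 ⧸ Ideal.span {Gp})
              ⟨IwasawaAlgebra.augIdealP 2, IwasawaAlgebra.isPrime_augIdealP_holds 2⟩ +
            lengthAt (IwasawaAlgebra 2) Yr.X ⟨IwasawaAlgebra.augIdealP 2, IwasawaAlgebra.isPrime_augIdealP_holds 2⟩)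
    (hord : IsOrdinaryAt W 2) (ht : ∀ x : ℚ, ¬ HasRationalTwoTorsionX W x) (hr : W.analyticRank = 0) (hbsd : BSDp W 2)
    {β : AlgebraicClosure ℚ} (hβ : aeval β W.twoTorsionPolynomial.toPoly = 0)
    (L : Type) [Field L] [NumberField L] [Algebra ↥(IntermediateField.adjoin ℚ ({β} : Set (AlgebraicClosure ℚ))) L]
    (hL : Module.finrank ↥(IntermediateField.adjoin ℚ ({β} : Set (AlgebraicClosure ℚ))) L = 1)
    (L' : Type) [Field L'] [NumberField L'] [Algebra ↥(IntermediateField.adjoin ℚ ({β} : Set (AlgebraicClosure ℚ))) L']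
    (hL' : Module.finrank ↥(IntermediateField.adjoin ℚ ({β} : Set (AlgebraicClosure ℚ))) L' = 2) (θ : L') (hθ : θ ^ 2 = 2)
    (hnarrow : (powMonoidHom (α := NarrowClassGroup L') 2).range.index = (powMonoidHom (α := NarrowClassGroup L) 2).range.index) :
    MazurMainConjecture W 2 :=
  mazurMainConjecture_two_of_muIneqRel_of_narrowClassGroup_layer_models_anyRung W h17 hGr hper hmod hGZK hI hord ht hr hbsd hβ (m := 0)
    L (by rw [hL]; rfl) (0 : L) (Function.iterate_zero_apply _ _) L' (by rw [hL']; rfl) θ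
    (by show θ ^ 2 - 2 = 0; rw [hθ, sub_self]) hnarrow

end Doors

/-! ## §4 Row `27735d1` — the first `0 < Δ_W` row — at the narrow rung `0` -/

/-- **ROW `27735d1` AT THE NARROW RUNG `0`** (the first `0 < Δ_W` row of the route; `N = 27735 = 3·5·43`, `Δ_min = 3¹⁵·5·43⁸ ≡ 7 (mod 8)`, `a₂ = +1`, `E[2]`
irreducible, rank `0`): PRINT⁵ {Kato 17.4 (1)(2) at `2` for `27735d1`, Greenberg 4.1, period unit, modularity, GZK} + MuIneqʳ (verbatim) + displayed {`r_an(27735d1) = 0`,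
`BSD₂(27735d1)` (`N > 5000`: not Creutz–Miller; bsd-2adic's `TowerClass.bsdp_two_27735d1_of_towerGap` is an alternative source); a model `L` of the totally real cubic
`ℚ(β)`, `4β³ + 5β² − 15391228β − 10203477656 = 0` (degree `1` over `ℚ(β)`), and a model `L' ∋ θ`, `θ² = 2`, of `ℚ(β)(√2)` (degree `2` over `ℚ(β)`) with
**`[Cl⁺(L') : Cl⁺(L')²] = [Cl⁺(L) : Cl⁺(L)²]`**} ⟹ `MC₂(27735d1)` — g25's row (p757810) one rung LOWER (fields of degrees `3` and `6` instead of `6` and `12`). DATA ASK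
(-data / -imc): the narrow 2-ranks of `Cl⁺(ℚ(β))` and `Cl⁺(ℚ(β, √2))`. CONDITIONAL; BSD is NOT proved. [cite: Fukuda1994, Thm. 1 (2), p. 264]
[cite: Kida1982JFields, main theorem (μ-part; shape only)] [cite: Kato2004Asterisque, Thm. 17.4 (1)(2) (p. 273)] [cite: GreenbergLNM1716, Thm. 4.1 (p. 102) and Conj. 1.11 (p. 58)]
[cite: CremonaAlgorithms1997, Table 1] -/
theorem mazurMainConjecture_two_27735d1_of_narrowClassGroup_rungZero_models
    (h17 : ∀ [NeZero (c27735d1.conductorNorm ℤ)] (f : CuspForm (Gamma0 (c27735d1.conductorNorm ℤ)) 2),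
      kato_divisibility_allPrimes c27735d1 2 (f := f))
    (hGr : Greenberg1999.thm41_charValue_rankZero_anyPrime)
    (hper : realPeriodRat_eq_unit_mul_plusPeriod_two) (hmod : nonempty_modularParametrizationData)
    (hGZK : rank_eq_analyticRank_of_analyticRank_le_one)
    (hI : ∀ (W : WeierstrassCurve ℚ) [W.IsElliptic] [W.IsGloballyMinimal], IsOrdinaryAt W 2 →
      (∀ x : ℚ, ¬ HasRationalTwoTorsionX W x) →
      ∀ (κ : ZpExtension ℚ 2) (γ : Field.absoluteGaloisGroup ℚ), κ.IsCyclotomic →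
      κ.IsTopGenerator γ → IsCyclotomicVariable 2 γ →
      ∀ ⦃N : ℕ⦄ [NeZero N] (f : CuspForm (Gamma0 N) 2), IsNewformOf W f →
      ∀ Gp : IwasawaAlgebra 2, iwasawaToPowerSeries 2 Gp = padicLFunction f (unitRoot W 2 : ℚ_[2]) →
      ∀ (D : W.SelmerDualData κ γ) (Yr : W.FineSelmerDualDataRelaxedInf κ γ),
        lengthAt (IwasawaAlgebra 2) D.X ⟨IwasawaAlgebra.augIdealP 2, IwasawaAlgebra.isPrime_augIdealP_holds 2⟩ ≤
          lengthAt (IwasawaAlgebra 2) (IwasawaAlgebra 2 ⧸ Ideal.span {Gp})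
              ⟨IwasawaAlgebra.augIdealP 2, IwasawaAlgebra.isPrime_augIdealP_holds 2⟩ +
            lengthAt (IwasawaAlgebra 2) Yr.X ⟨IwasawaAlgebra.augIdealP 2, IwasawaAlgebra.isPrime_augIdealP_holds 2⟩)
    (hr0 : c27735d1.analyticRank = 0) (hbsd : BSDp c27735d1 2)
    {β : AlgebraicClosure ℚ} (hβ : aeval β c27735d1.twoTorsionPolynomial.toPoly = 0)
    (L : Type) [Field L] [NumberField L] [Algebra ↥(IntermediateField.adjoin ℚ ({β} : Set (AlgebraicClosure ℚ))) L]
    (hL : Module.finrank ↥(IntermediateField.adjoin ℚ ({β} : Set (AlgebraicClosure ℚ))) L = 1)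
    (L' : Type) [Field L'] [NumberField L'] [Algebra ↥(IntermediateField.adjoin ℚ ({β} : Set (AlgebraicClosure ℚ))) L']
    (hL' : Module.finrank ↥(IntermediateField.adjoin ℚ ({β} : Set (AlgebraicClosure ℚ))) L' = 2) (θ : L') (hθ : θ ^ 2 = 2)
    (hnarrow : (powMonoidHom (α := NarrowClassGroup L') 2).range.index = (powMonoidHom (α := NarrowClassGroup L) 2).range.index) :
    MazurMainConjecture c27735d1 2 :=
  mazurMainConjecture_two_of_muIneqRel_of_narrowClassGroup_rungZero_models c27735d1 h17 hGr hper hmod hGZK hI goodOrd_two_27735d1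
    not_hasRationalTwoTorsionX_27735d1 hr0 hbsd hβ L hL L' hL' θ hθ hnarrow

end Summit.BirchSwinnertonDyer.BirchSwinnertonDyer.Theorems.AlignedTransportAtTwoCubicNarrowRankDoorModelsAnyRung

end
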